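import Mathlib
import HarnessLib
import Literature.Analysis.FluidPDE.Tao2016AveragedNS.TaylorChainCertificate
import Summits.NavierStokesRegularity.NavierStokesRegularity.Theorems.TaylorModelRungThreeReadoutPackage
import Summits.NavierStokesRegularity.NavierStokesRegularity.Theorems.TaylorModelRungThreeReadoutCoords

/-!
# Line `taylor-model` on crux K1b-DR (stmt-NavierStokesRegularity-23954) — stub G3 (`stub_tube : TubeLip`),
# helper file 2: flow property, linearity of `Vap`, (F4) Lipschitz estimate

Helper lemmas (namespace `…Theorems.TaylorModelReadout.G3`) over an ABSTRACT flow package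
`IsFlowPackage cd φ` (`…TaylorModelRungThreeReadoutPackage`), used by the proof of the registered stub
`stub_tube : TubeLip` of skeleton v4 (line owner ns-idea-2 g3):

* the FLOW PROPERTY from (F2) uniqueness: a solution of K1b-DR's ODE clause restarted at time `T₁` is the
  package's flow from its state there (`flow_shift`, `stAt_shift`), window support of states (F0);
* linearity and window support of the certificate's variational polynomial `Vap j s u` (induction on the
  `Wv` recursion of `Chain`, bilinearity of `Qb` from `…ReadoutCoords`);
* the two-point Lipschitz estimate along a segment from the segment-derivative clause (F4) and the mean
  value inequality (`inBall_sub_of_F4`).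

MODEL-lattice bookkeeping only (rung TL-M3 of the NS ladder); nothing here is a statement about the
Navier–Stokes equations.
-/

noncomputable section

-- the sub-problem namespace repeats the summit name by design (D-0017)
set_option linter.dupNamespace false

namespace Summit.NavierStokesRegularity.NavierStokesRegularity.Theorems.TaylorModelReadout.G3

open Set Filter
open Literature.Analysis.FluidPDE.TaoCascade Literature.Analysis.FluidPDE.TaoCascade.TaylorChain
open Summit.NavierStokesRegularity.NavierStokesRegularity.Theorems.TaylorModelReadout

variable {cd : CertData} {j : ℕ}

/-! ### The flow property of a flow package -/

variable {φ : Flow}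

/-- Time shift of K1b-DR's ODE clause: a solution on `[0, T]` restarted at time `T₁` solves on `[0, T − T₁]`
from its state at `T₁`; by (F2) uniqueness it is the package's flow from that state (FLOW PROPERTY,
window components). [folklore] -/
theorem flow_shift (hF : IsFlowPackage cd φ) (hj : j ≤ cd.N₀) {y : Fin 4 → ℤ → ℝ} {T T₁ : ℝ}
    (hy : SolvesOn cd φ j y T) (h0 : 0 ≤ T₁) (h1 : T₁ ≤ T) :
    ∀ i k, -cd.Kb ≤ k → k ≤ cd.Ka → ∀ s ∈ Icc 0 (T - T₁),
      φ j y i k (T₁ + s) = φ j (stAt φ j y T₁) i k s := by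
  have hψ : ∀ i k, -cd.Kb ≤ k → k ≤ cd.Ka →
      (fun i k s => φ j y i k (T₁ + s)) i k 0 = stAt φ j y T₁ i k ∧ ∀ t' ∈ Icc 0 (T - T₁),
        HasDerivWithinAt ((fun i k s => φ j y i k (T₁ + s)) i k)
          (Literature.Analysis.FluidPDE.TaoCascade.quadTerm 1 cd.α
            (fun j' n s' => if -cd.Kb ≤ n ∧ n ≤ cd.Ka then (fun i k s => φ j y i k (T₁ + s)) j' n s' else 0)
            i k t') (Icc 0 (T - T₁)) t' := by
    intro i k hk1 hk2
    refine ⟨by simp [stAt], fun t' ht' => ?_⟩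
    have hd := (hy i k hk1 hk2).2 (T₁ + t') ⟨by linarith [ht'.1], by linarith [ht'.2]⟩
    have hcomp := hd.comp t' ((hasDerivWithinAt_id t' (Icc 0 (T - T₁))).const_add T₁)
      (fun s hs => ⟨by linarith [hs.1], by linarith [hs.2]⟩)
    rw [mul_one] at hcomp
    exact hcomp
  intro i k hk1 hk2 s hs
  exact (hF j hj).2.2.1 (stAt φ j y T₁) (T - T₁) (fun i k s => φ j y i k (T₁ + s)) (by linarith) hψ
    i k hk1 hk2 s hs

/-- The flow property on whole states (off-window components vanish by (F0)). [folklore] -/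
theorem stAt_shift (hF : IsFlowPackage cd φ) (hj : j ≤ cd.N₀) {y : Fin 4 → ℤ → ℝ} {T T₁ s : ℝ}
    (hy : SolvesOn cd φ j y T) (h0 : 0 ≤ T₁) (hs : s ∈ Icc 0 (T - T₁)) :
    stAt φ j y (T₁ + s) = stAt φ j (stAt φ j y T₁) s := by
  funext i k
  by_cases hk : -cd.Kb ≤ k ∧ k ≤ cd.Ka
  · exact flow_shift hF hj hy h0 (by linarith [hs.1, hs.2]) i k hk.1 hk.2 s hs
  · simp only [stAt]
    rw [(hF j hj).1 y i k hk, (hF j hj).1 _ i k hk]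

/-- States of a flow package are window-supported. [folklore] -/
theorem wsupp_stAt (hF : IsFlowPackage cd φ) (hj : j ≤ cd.N₀) (y : Fin 4 → ℤ → ℝ) (t : ℝ) :
    cd.Wsupp (stAt φ j y t) := fun i k hk => (hF j hj).1 y i k hk t

/-- Differences of states of a flow package are window-supported. [folklore] -/
theorem wsupp_stAt_sub (hF : IsFlowPackage cd φ) (hj : j ≤ cd.N₀) (y y' : Fin 4 → ℤ → ℝ) (t t' : ℝ) :
    cd.Wsupp (stAt φ j y t - stAt φ j y' t') := fun i k hk => by
  simp only [Pi.sub_apply, wsupp_stAt hF hj y t i k hk, wsupp_stAt hF hj y' t' i k hk, sub_zero]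

/-- A solution starts at its datum: `stAt φ j z 0 − z` vanishes on the window. [folklore] -/
theorem inBall_stAt_zero_sub {z : Fin 4 → ℤ → ℝ} {T : ℝ}
    (hz : SolvesOn cd φ j z T) : cd.InBall j (stAt φ j z 0 - z) 0 := by
  intro i k hk1 hk2
  simp only [Pi.sub_apply, stAt, (hz i k hk1 hk2).1, sub_self, abs_zero, zero_mul, le_refl]

/-! ### The variational polynomial `Vap` is linear and window-supported -/

/-- `Wv j s n` is additive in the direction for `n ≤ pdeg`. [folklore] -/
theorem Wv_add (hV : cd.Valid) (hj : j ≤ cd.N₀) {s : ℕ} (hs : s ≤ cd.S j) :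
    ∀ n, n ≤ cd.pdeg → ∀ v v' : (Fin 4 → ℤ → ℝ), cd.Wv j s n (v + v') = cd.Wv j s n v + cd.Wv j s n v' := by
  have h19 := ((hV.2.2.1 j hj).2.2.2.2.2.2.1 s hs).2.2.2.2.2.2.2.2.2.2.2.2.2.2.2.2.2.2.1
  have h20 := ((hV.2.2.1 j hj).2.2.2.2.2.2.1 s hs).2.2.2.2.2.2.2.2.2.2.2.2.2.2.2.2.2.2.2
  intro n
  induction n using Nat.strong_induction_on with
  | _ n ih =>
    intro hn v v'
    rcases n with _ | n
    · funext i k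
      simp only [Pi.add_apply, h19]
      split_ifs <;> simp
    · have hlt : n < cd.pdeg := by omega
      funext i k
      have hne : ((n : ℝ) + 1) ≠ 0 := by positivity
      show cd.Wv j s (n + 1) (v + v') i k = cd.Wv j s (n + 1) v i k + cd.Wv j s (n + 1) v' i k
      apply mul_left_cancel₀ hne
      rw [mul_add, h20 n hlt (v + v') i k, h20 n hlt v i k, h20 n hlt v' i k,
        ← Finset.sum_add_distrib]
      refine Finset.sum_congr rfl fun m' hm' => ?_
      rw [ih (n - m') (by omega) (by omega) v v', Qb_add_right, Qb_add_left]
      simp only [Pi.add_apply]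
      ring

/-- `Wv j s n` is homogeneous in the direction for `n ≤ pdeg`. [folklore] -/
theorem Wv_smul (hV : cd.Valid) (hj : j ≤ cd.N₀) {s : ℕ} (hs : s ≤ cd.S j) :
    ∀ n, n ≤ cd.pdeg → ∀ (r : ℝ) (v : Fin 4 → ℤ → ℝ), cd.Wv j s n (r • v) = r • cd.Wv j s n v := by
  have h19 := ((hV.2.2.1 j hj).2.2.2.2.2.2.1 s hs).2.2.2.2.2.2.2.2.2.2.2.2.2.2.2.2.2.2.1
  have h20 := ((hV.2.2.1 j hj).2.2.2.2.2.2.1 s hs).2.2.2.2.2.2.2.2.2.2.2.2.2.2.2.2.2.2.2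
  intro n
  induction n using Nat.strong_induction_on with
  | _ n ih =>
    intro hn r v
    rcases n with _ | n
    · funext i k
      simp only [Pi.smul_apply, smul_eq_mul, h19]
      split_ifs <;> simp
    · have hlt : n < cd.pdeg := by omega
      funext i k
      have hne : ((n : ℝ) + 1) ≠ 0 := by positivity
      show cd.Wv j s (n + 1) (r • v) i k = r * cd.Wv j s (n + 1) v i k
      apply mul_left_cancel₀ hne
      rw [mul_left_comm, h20 n hlt (r • v) i k, h20 n hlt v i k, Finset.mul_sum]
      refine Finset.sum_congr rfl fun m' hm' => ?_
      rw [ih (n - m') (by omega) (by omega) r v, Qb_smul_right, Qb_smul_left]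
      simp only [Pi.smul_apply, smul_eq_mul]
      ring

/-- `Wv j s n v` is window-supported for `n ≤ pdeg`. [folklore] -/
theorem wsupp_Wv (hV : cd.Valid) (hj : j ≤ cd.N₀) {s : ℕ} (hs : s ≤ cd.S j) :
    ∀ n, n ≤ cd.pdeg → ∀ v : (Fin 4 → ℤ → ℝ), cd.Wsupp (cd.Wv j s n v) := by
  have h19 := ((hV.2.2.1 j hj).2.2.2.2.2.2.1 s hs).2.2.2.2.2.2.2.2.2.2.2.2.2.2.2.2.2.2.1
  have h20 := ((hV.2.2.1 j hj).2.2.2.2.2.2.1 s hs).2.2.2.2.2.2.2.2.2.2.2.2.2.2.2.2.2.2.2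
  intro n hn v i k hk
  rcases n with _ | n
  · rw [h19]; simp [hk]
  · have hlt : n < cd.pdeg := by omega
    have hne : ((n : ℝ) + 1) ≠ 0 := by positivity
    apply mul_left_cancel₀ hne
    rw [h20 n hlt v i k, mul_zero]
    refine Finset.sum_eq_zero fun m' _ => ?_
    rw [wsupp_Qb cd _ _ i k hk, wsupp_Qb cd _ _ i k hk, add_zero]

/-- The variational polynomial `Vap j s u` is `ℝ`-linear in the direction. [folklore] -/
theorem isLinearMap_Vap (hV : cd.Valid) (hj : j ≤ cd.N₀) {s : ℕ} (hs : s ≤ cd.S j) (u : ℝ) :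
    IsLinearMap ℝ (cd.Vap j s u) := by
  constructor
  · intro v v'
    funext i k
    simp only [CertData.Vap, Pi.add_apply, ← Finset.sum_add_distrib]
    refine Finset.sum_congr rfl fun n hn => ?_
    rw [Wv_add hV hj hs n (by simpa [Finset.mem_range, Nat.lt_succ_iff] using hn), Pi.add_apply,
      Pi.add_apply, add_mul]
  · intro r v
    funext i k
    simp only [CertData.Vap, Pi.smul_apply, smul_eq_mul, Finset.mul_sum]
    refine Finset.sum_congr rfl fun n hn => ?_
    rw [Wv_smul hV hj hs n (by simpa [Finset.mem_range, Nat.lt_succ_iff] using hn), Pi.smul_apply,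
      Pi.smul_apply, smul_eq_mul, mul_assoc]

/-- The variational polynomial is window-supported. [folklore] -/
theorem wsupp_Vap (hV : cd.Valid) (hj : j ≤ cd.N₀) {s : ℕ} (hs : s ≤ cd.S j) (u : ℝ)
    (v : Fin 4 → ℤ → ℝ) : cd.Wsupp (cd.Vap j s u v) := by
  intro i k hk
  simp only [CertData.Vap]
  refine Finset.sum_eq_zero fun n hn => ?_
  rw [wsupp_Wv hV hj hs n (by simpa [Finset.mem_range, Nat.lt_succ_iff] using hn) v i k hk, zero_mul]

/-! ### Two-point Lipschitz estimate from the segment-derivative clause (F4) -/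

/-- From (F4) at a base point `x` (radius `ρ`, horizon `T`, guard) and the mean value inequality: two
points of `x + Ball(ρ)` at window distance `dd` have flows at window distance `dd/(1 − bb(m+ρ)t')²` at
every time `t' ≤ T`. [folklore] -/
theorem inBall_sub_of_F4 (hF : IsFlowPackage cd φ) (hj : j ≤ cd.N₀) {x : Fin 4 → ℤ → ℝ} {m ρ T : ℝ}
    (hm : 0 ≤ m) (hρ : 0 ≤ ρ) (hx : cd.InBall j x m) (hT : 0 ≤ T) (hg : cd.bb j * (m + ρ) * T < 1)
    {z z' : Fin 4 → ℤ → ℝ} {dd : ℝ} (hz : cd.InBall j (z - x) ρ) (hz' : cd.InBall j (z' - x) ρ)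
    (hzz : cd.InBall j (z - z') dd) {t' : ℝ} (ht' : t' ∈ Icc 0 T) :
    cd.InBall j (stAt φ j z t' - stAt φ j z' t') ((1 / (1 - cd.bb j * (m + ρ) * t') ^ 2) * dd) := by
  intro i k hk1 hk2
  obtain ⟨ψ, hψ⟩ := (hF j hj).2.2.2.2.1 x m ρ T hm hρ hx hT hg z z' dd hz hz' hzz i k hk1 hk2 t' ht'
  have hmvt := Convex.norm_image_sub_le_of_norm_hasDerivWithin_le (s := Icc (0:ℝ) 1)
    (f := fun σ' : ℝ => φ j (z' + σ' • (z - z')) i k t') (f' := ψ)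
    (C := 1 / (1 - cd.bb j * (m + ρ) * t') ^ 2 * dd * cd.ω j k)
    (fun σ hσ => (hψ σ hσ).1) (fun σ hσ => by rw [Real.norm_eq_abs]; exact (hψ σ hσ).2)
    (convex_Icc 0 1) (left_mem_Icc.mpr zero_le_one) (right_mem_Icc.mpr zero_le_one)
  simp only [one_smul, zero_smul, add_zero, add_sub_cancel, Real.norm_eq_abs, sub_zero, abs_one,
    mul_one] at hmvt
  simp only [Pi.sub_apply, stAt]
  calc |φ j z i k t' - φ j z' i k t'| ≤ 1 / (1 - cd.bb j * (m + ρ) * t') ^ 2 * dd * cd.ω j k := hmvt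
    _ = 1 / (1 - cd.bb j * (m + ρ) * t') ^ 2 * dd * cd.ω j k := rfl

end Summit.NavierStokesRegularity.NavierStokesRegularity.Theorems.TaylorModelReadout.G3

end
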